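import Literature.NumberTheory.LFunctions.LandauSiegelZerosLocalHypothesisH
import HarnessLib

/-!
# A conditional refinement of Page's theorem under the shrinking-disk hypothesis `H_f`
# (Basak–Pratt, *Res. Number Theory* 12 (2026), Hypothesis `H_f`, Theorem 1.2, Remarks 1.1–1.3)

Topic `Literature/NumberTheory/LFunctions` (namespace `Literature.NumberTheory.LFunctions`, paper
vocabulary in the sub-namespace `BasakPratt2026`). Typed for the cell `landau-siegel` (LANDAU–SIEGEL
PROGRAMME, rung F-S3, sub-cell §C literature harvest, reader r6 «explicit-formula / GRH-fragment
CONDITIONAL statements on exceptional zeros»), statement-first (D-0014/D-0064): ONE named fact (the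
paper's only theorem) plus the hypothesis as a plain PREDICATE and PROVED bookkeeping relating it to
the tree's `H_δ` of Basak–Thorner–Zaharescu (`BasakThornerZaharescu2026.LocalRealZeros`,
`LandauSiegelZerosLocalHypothesisH.lean`, which is CITED, not retyped).

Source: D. Basak, K. Pratt, *A Conditional Refinement of Page's Theorem on zeros of Dirichlet
`L`-functions*, Res. Number Theory **12** (2026), doi:10.1007/s40993-025-00695-x (PUBLISHED), held as
arXiv:2607.06433 (`paper:arxiv-2607.06433`, corpus TeX, chunks p0003–p0007 read 2026-08-26; the TeX
chunks carry no PDF pagination, locators below are chunk:line).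

## What the source says (verbatim where it matters)

* §1 (p0003): "`𝒮 := {χ mod q_χ : χ primitive and real}`", and for `Q ≥ 2`,
  "`𝒮(Q) = {χ mod q_χ : χ primitive and real, 1 ≤ q_χ ≤ Q}`". **Theorem 1.1 (Page).** "There exists
  an absolute constant `c > 0` such that … for any `Q ≥ 2`,
  `#{χ ∈ 𝒮(Q) : L(s, χ) has a real zero in [1 − c(log Q)^{−1}, 1)} ≤ 1`." (The tree's form of
  Landau–Page: `Literature.Barriers.RiemannHypothesis.Iwaniec2006_landauRepulsion`, PROVED there —
  cited, not retyped.)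
* **Hypothesis (`H_f`)** (p0004:L3–L5). "Let `f(x)` be a positive real-valued increasing function with
  `lim_{x→∞} f(x) = ∞`. For `χ mod q_χ` primitive and real, we say `L(s, χ)` satisfies Hypothesis
  `H_f` provided all the zeros of `L(s, χ)` inside the disk `|s − 1| < 1/f(q_χ)`, if any, are real."
* **Theorem 1.2** (p0004:L9–L22). "Let `ν : ℝ → ℝ_{>0}` be a positive, real-valued function satisfying
  the following conditions: 1. `lim_{x→∞} ν(x) = 0`. 2. For `x > 1`, the function
  `f(x) := (log x)^{ν(x)}` is increasing, and `lim_{x→∞} f(x) = ∞`. Let `ε > 0`. There exists an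
  effectively computable constant `Q₀ = Q₀(ν, ε) ≥ 1` depending at most on `ν` and `ε` with the
  following property. For any `Q ≥ Q₀` for which Hypothesis `H_f` holds for all `χ ∈ 𝒮(Q²)`, we have
  `#{χ ∈ 𝒮(Q) : L(s, χ) has a real zero in [1 − (log Q)^{−ε}, 1)} ≤ 1`." ("For an explicit
  permissible expression for `Q₀(ν, ε)`, see (2.x)": `Q₀ = max{Q_{ν,ε}, exp(B₈ 2^{ε/2}/ε)^{2/ε}}` with
  `|ν(Q²)| ≤ ε/2` for `Q ≥ Q_{ν,ε}` and `B₈` an unspecified absolute constant, p0006:L60–L66 — not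
  numerically explicit, so effectivity is recorded here only.)
* **Remark 1.1** (p0004:L26–L31). "Hypothesis `H_f` in Theorem 1.2 is weaker than Hypothesis `H_δ`,
  since for `q_χ` sufficiently large and any fixed `δ > 0`, we have `1/f(q_χ) < δ`."
* **Remark 1.2** (p0004:L33–L35). "a density one subset of `χ ∈ 𝒮` satisfy `H_δ`, as well as
  Hypothesis `H_f` … [Heath-Brown, Acta Arith. 72 (1995)]. In contrast, the hypothesis used in the
  work of Sarnak and Zaharescu has not been verified for any `χ ∈ 𝒮` yet."
* **Remark 1.3** / §3 (p0004:L37–L45; p0007:L40–L60): under `H_f` for all `χ ∈ 𝒮(Q²)` the exceptional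
  moduli satisfy `q_{j+1} > exp((log q₁)^A)` and their number up to `Q` is `O_ν(log log log Q)`
  (INDEX ONLY — a consequence, not typed).
* §3 (p0007:L14–L25), the measured limit of the method: "(Eq: Crucial) may fail when `q₁` is
  significantly larger than `q₂`. For example, if `f(x) = log log x` and we set
  `q₁ = ⌈q₂^{−1} exp(q₂)⌉` … Turán's power sum method fails in this situation. To overcome this
  issue, it is necessary to impose an upper bound on `q₁`" (recorded for the harvest; nothing typed).

## Lean rendering / design choices

* `f` is determined by `ν`: `BasakPratt2026.growth ν x = (log x)^{ν x}` (real power `Real.rpow`).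
  The four printed conditions on `ν` are hypotheses of the named fact, rendered with Mathlib's
  `Filter.Tendsto` (`ν → 0`, `f → ∞` along `atTop`) and `MonotoneOn f (Set.Ioi 1)` ("for `x > 1`,
  `f` is increasing" — read as non-decreasing; a strictly increasing `f` satisfies it, so the
  rendered fact is at most WEAKER than print).
* "`H_f` holds for all `χ ∈ 𝒮(X)`" = `BasakPratt2026.ShrinkingDiskRealZeros f X`: for every modulus
  `1 ≤ q ≤ X` (`[NeZero q]`, `(q : ℝ) ≤ X`) and every primitive quadratic (= real, possibly trivial)
  `χ mod q`, every zero `s` of Mathlib's `χ.LFunction` with `‖s − 1‖ < 1/f(q)` has `Im s = 0` — the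
  same idiom as the tree's `LocalRealZeros δ` with the fixed radius `δ` replaced by `1/f(q)`. (For the
  trivial character mod `1`, `LFunction` is `ζ` off `s = 1` and Mathlib's junk value AT `s = 1`; a
  spurious "zero" at `s = 1` would be real anyway, so the junk value cannot falsify the predicate.)
  CAVEAT recorded, not altered: for small conductors the disk `|s − 1| < 1/f(q)` may have radius
  `≥ 1/2` and then contains a piece of the critical line, so `H_f` for ALL `χ ∈ 𝒮(Q²)` is implied by
  GRH only when `f(q) ≥ 2` on the relevant moduli (`ShrinkingDiskRealZeros.of_localRealZeros` below
  makes the comparison precise); the paper states the hypothesis exactly so, and so do we.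
* "`#{χ ∈ 𝒮(Q) : L(s, χ) has a real zero in [1 − w, 1)} ≤ 1`" (`w = (log Q)^{−ε}`) is rendered, as in
  the tree's `basakThornerZaharescu2026_theorem11` and `Iwaniec2006_landauRepulsion`, by two clauses
  free of heterogeneous equality of characters: (a) characters to DIFFERENT moduli `q₁ ≠ q₂ ≤ Q` do not
  both have a real zero `β ∈ [1 − w, 1)`; (b) two DISTINCT characters to the SAME modulus `q ≤ Q` do
  not both — `BasakPratt2026.AtMostOneRealZeroNear Q w`. "Real zero in `[1 − w, 1)`" = real `β < 1`
  with `L(β, χ) = 0` and `1 − w ≤ β`; the negation is written `β < 1 − w`.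
* `Q` and `Q₀` are real (`Q ≥ Q₀ ≥ 1`); "effectively computable `Q₀`" is `∃ Q₀` (see above).

PROVED here: `ShrinkingDiskRealZeros.anti` (monotone in the range `X`),
`ShrinkingDiskRealZeros.mono_fun` (a pointwise larger `f` is a weaker hypothesis),
`ShrinkingDiskRealZeros.of_localRealZeros` (Remark 1.1 made quantitative: `H_δ` implies `H_f` on
every range of moduli where `1/f(q) ≤ δ`), `ShrinkingDiskRealZeros.of_generalizedRiemannHypothesis`
(GRH implies `H_f` on every range where `f ≥ 2`), and `AtMostOneRealZeroNear.anti` (monotone in the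
window). NOT typed: Remark 1.3's lacunarity count; the extensions to higher-order characters and
Hecke–Maaß forms mentioned at the end of §1.

LABEL (cell rule): statement layer / literature harvest. WHAT THIS IS NOT: no claim that `H_f` holds
for any character; Theorem 1.2's conclusion is «at most one per scale `Q`», which — unlike
Basak–Thorner–Zaharescu's Corollary 1.4 (`LocalRealZeros.noSiegelZeros` in the tree) — does NOT by
itself exclude or bound the quality of an exceptional zero (the windows `[1 − (log Q)^{−ε}, 1)` shrink
with `Q`, so a fixed exceptional zero leaves them; §3 of the paper explains why the per-character
form is out of reach of the method under `H_f`). «The programme SEARCHES and TYPES; no claim about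
Landau–Siegel zeros, Theorems 1–2 of arXiv:2211.02515 or a repaired Margin232 until a kernel theorem
says so.»

## References

* [BasakPratt2026] D. Basak, K. Pratt, *A Conditional Refinement of Page's Theorem on zeros of
  Dirichlet L-functions*, Res. Number Theory 12 (2026), doi:10.1007/s40993-025-00695-x =
  arXiv:2607.06433 — §1 Hypothesis `H_f`, Theorem 1.2, Remarks 1.1–1.3; §2 (proof, Turán power sums);
  §3 (comparison with [BasakThornerZaharescu2026]).
* [BasakThornerZaharescu2026] Algebra & Number Theory 20 (2026) 209–217 — Hypothesis `H_δ`
  (tree: `BasakThornerZaharescu2026.LocalRealZeros`).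
* [SarnakZaharescu2002] Duke Math. J. 111 (2002) — Hypothesis H (tree: `ModifiedGRH`).
-/

noncomputable section

open Complex Filter

namespace Literature.NumberTheory.LFunctions

namespace BasakPratt2026

/-- The growth function of Theorem 1.2: `f(x) = (log x)^{ν(x)}`.
[cite: BasakPratt2026, Theorem 1.2 (condition 2)] -/
def growth (ν : ℝ → ℝ) (x : ℝ) : ℝ :=
  Real.log x ^ ν x

/-- **Hypothesis `H_f` for every `χ ∈ 𝒮(X)`** (Basak–Pratt): for every modulus `q ≤ X` and every
primitive real Dirichlet character `χ mod q`, all zeros of `L(s, χ)` in the open disk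
`|s − 1| < 1/f(q)` are REAL. A PREDICATE (a closed hypothesis for each `f`, `X`), never asserted.
[cite: BasakPratt2026, §1 Hypothesis H_f and Theorem 1.2] -/
def ShrinkingDiskRealZeros (f : ℝ → ℝ) (X : ℝ) : Prop :=
  ∀ (q : ℕ) [NeZero q], (q : ℝ) ≤ X → ∀ χ : DirichletCharacter ℂ q, χ.IsQuadratic → χ.IsPrimitive →
    ∀ s : ℂ, χ.LFunction s = 0 → ‖s - 1‖ < 1 / f q → s.im = 0

/-- **"`#{χ ∈ 𝒮(Q) : L(s, χ) has a real zero in [1 − w, 1)} ≤ 1`"**, rendered as two clauses (different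
moduli / same modulus, distinct characters): among the primitive real characters of modulus `≤ Q`,
no two distinct ones both have a real zero `β` with `1 − w ≤ β < 1`.
[cite: BasakPratt2026, Theorem 1.2 (conclusion) and Theorem 1.1] -/
def AtMostOneRealZeroNear (Q w : ℝ) : Prop :=
  (∀ (q₁ q₂ : ℕ) [NeZero q₁] [NeZero q₂] (χ₁ : DirichletCharacter ℂ q₁)
      (χ₂ : DirichletCharacter ℂ q₂), q₁ ≠ q₂ → (q₁ : ℝ) ≤ Q → (q₂ : ℝ) ≤ Q →
      χ₁.IsQuadratic → χ₁.IsPrimitive → χ₂.IsQuadratic → χ₂.IsPrimitive →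
      ∀ β₁ β₂ : ℝ, χ₁.LFunction β₁ = 0 → χ₂.LFunction β₂ = 0 → β₁ < 1 → β₂ < 1 →
        β₁ < 1 - w ∨ β₂ < 1 - w) ∧
  (∀ (q : ℕ) [NeZero q] (χ₁ χ₂ : DirichletCharacter ℂ q), χ₁ ≠ χ₂ → (q : ℝ) ≤ Q →
      χ₁.IsQuadratic → χ₁.IsPrimitive → χ₂.IsQuadratic → χ₂.IsPrimitive →
      ∀ β₁ β₂ : ℝ, χ₁.LFunction β₁ = 0 → χ₂.LFunction β₂ = 0 → β₁ < 1 → β₂ < 1 →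
        β₁ < 1 - w ∨ β₂ < 1 - w)

/-- `H_f` on a range of moduli is monotone in the range. [cite: BasakPratt2026, §1 Hypothesis H_f] -/
theorem ShrinkingDiskRealZeros.anti {f : ℝ → ℝ} {X X' : ℝ} (hle : X' ≤ X)
    (h : ShrinkingDiskRealZeros f X) : ShrinkingDiskRealZeros f X' :=
  fun q _ hq χ hquad hprim s hs hdist => h q (le_trans hq hle) χ hquad hprim s hs hdist

/-- A pointwise larger positive `f` (smaller disks) gives a weaker hypothesis.
[cite: BasakPratt2026, Remark 1.1] -/
theorem ShrinkingDiskRealZeros.mono_fun {f g : ℝ → ℝ} {X : ℝ}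
    (hfg : ∀ q : ℕ, 1 ≤ q → (q : ℝ) ≤ X → 0 < f q ∧ f q ≤ g q)
    (h : ShrinkingDiskRealZeros f X) : ShrinkingDiskRealZeros g X := by
  intro q _ hq χ hquad hprim s hs hdist
  have hq1 : 1 ≤ q := Nat.one_le_iff_ne_zero.mpr (NeZero.ne q)
  obtain ⟨hfpos, hfg'⟩ := hfg q hq1 hq
  refine h q hq χ hquad hprim s hs (lt_of_lt_of_le hdist ?_)
  exact one_div_le_one_div_of_le hfpos hfg'

/-- **Remark 1.1, quantitative form (PROVED): `H_δ` implies `H_f` on every range of moduli where the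
disks `|s − 1| < 1/f(q)` sit inside `|s − 1| < δ`**, i.e. where `1/f(q) ≤ δ`.
[cite: BasakPratt2026, Remark 1.1] [cite: BasakThornerZaharescu2026, §1 Hypothesis H_δ] -/
theorem ShrinkingDiskRealZeros.of_localRealZeros {δ : ℝ} (hH : BasakThornerZaharescu2026.LocalRealZeros δ)
    {f : ℝ → ℝ} {X : ℝ} (hf : ∀ q : ℕ, 1 ≤ q → (q : ℝ) ≤ X → 1 / f q ≤ δ) :
    ShrinkingDiskRealZeros f X := by
  intro q _ hq χ hquad hprim s hs hdist
  have hq1 : 1 ≤ q := Nat.one_le_iff_ne_zero.mpr (NeZero.ne q)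
  exact hH q χ hquad hprim s hs (lt_of_lt_of_le hdist (hf q hq1 hq))

/-- **GRH implies `H_f` on every range of moduli where `f ≥ 2`** (there the disks have radius `≤ 1/2`
and miss the critical line), through the tree's PROVED `GRH ⇒ H_{1/2}`
(`BasakThornerZaharescu2026.LocalRealZeros.of_generalizedRiemannHypothesis`). For moduli with
`f(q) < 2` the hypothesis `H_f` is NOT a consequence of GRH (the disk meets `Re s = 1/2`).
[cite: BasakPratt2026, §1 Hypothesis H_f and Remark 1.1] -/
theorem ShrinkingDiskRealZeros.of_generalizedRiemannHypothesis (hGRH : GeneralizedRiemannHypothesis)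
    {f : ℝ → ℝ} {X : ℝ} (hf : ∀ q : ℕ, 1 ≤ q → (q : ℝ) ≤ X → 2 ≤ f q) :
    ShrinkingDiskRealZeros f X := by
  refine ShrinkingDiskRealZeros.of_localRealZeros
    (BasakThornerZaharescu2026.LocalRealZeros.of_generalizedRiemannHypothesis hGRH le_rfl) ?_
  intro q hq1 hq
  have h2 : (2 : ℝ) ≤ f q := hf q hq1 hq
  have hpos : 0 < f q := lt_of_lt_of_le (by norm_num) h2
  rw [div_le_iff₀ hpos]
  linarith

/-- The conclusion is monotone in the window: a narrower window is a weaker statement.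
[cite: BasakPratt2026, Theorem 1.2 (conclusion)] -/
theorem AtMostOneRealZeroNear.anti {Q w w' : ℝ} (hle : w' ≤ w) (h : AtMostOneRealZeroNear Q w) :
    AtMostOneRealZeroNear Q w' := by
  obtain ⟨ha, hb⟩ := h
  refine ⟨?_, ?_⟩
  · intro q₁ q₂ _ _ χ₁ χ₂ hne hq₁ hq₂ h1q h1p h2q h2p β₁ β₂ hz₁ hz₂ hβ₁ hβ₂
    rcases ha q₁ q₂ χ₁ χ₂ hne hq₁ hq₂ h1q h1p h2q h2p β₁ β₂ hz₁ hz₂ hβ₁ hβ₂ with h | h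
    · exact Or.inl (by linarith)
    · exact Or.inr (by linarith)
  · intro q _ χ₁ χ₂ hne hq h1q h1p h2q h2p β₁ β₂ hz₁ hz₂ hβ₁ hβ₂
    rcases hb q χ₁ χ₂ hne hq h1q h1p h2q h2p β₁ β₂ hz₁ hz₂ hβ₁ hβ₂ with h | h
    · exact Or.inl (by linarith)
    · exact Or.inr (by linarith)

end BasakPratt2026

open BasakPratt2026

/-- **Basak–Pratt 2026, Theorem 1.2 (NAMED FACT, as printed).** "Let `ν : ℝ → ℝ_{>0}` be a
positive, real-valued function satisfying the following conditions: 1. `lim_{x→∞} ν(x) = 0`. 2. For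
`x > 1`, the function `f(x) := (log x)^{ν(x)}` is increasing, and `lim_{x→∞} f(x) = ∞`. Let `ε > 0`.
There exists an effectively computable constant `Q₀ = Q₀(ν, ε) ≥ 1` depending at most on `ν` and `ε`
with the following property. For any `Q ≥ Q₀` for which Hypothesis `H_f` holds for all
`χ ∈ 𝒮(Q²)`, we have `#{χ ∈ 𝒮(Q) : L(s, χ) has a real zero in [1 − (log Q)^{−ε}, 1)} ≤ 1`."
Rendered: for every such `ν` and every `ε > 0` there is `Q₀ ≥ 1` such that for all real `Q ≥ Q₀`,
`ShrinkingDiskRealZeros (growth ν) (Q²)` implies `AtMostOneRealZeroNear Q ((log Q)^{−ε})`.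
Status: preprint claim, unrefereed [claim: BasakPratt2026, status: under-review] (Turán's power sum
method on `ζ(s)L(s,χ₁)L(s,χ₂)L(s,ψ)`, §2); unproved here.
Effectivity of `Q₀` is not expressible and is recorded in the module docstring only.
[cite: BasakPratt2026, Theorem 1.2] -/
def basakPratt2026_theorem12 : Prop :=
  ∀ ν : ℝ → ℝ, (∀ x, 0 < ν x) → Tendsto ν atTop (nhds 0) →
    MonotoneOn (growth ν) (Set.Ioi 1) → Tendsto (growth ν) atTop atTop →
    ∀ ε : ℝ, 0 < ε → ∃ Q₀ : ℝ, 1 ≤ Q₀ ∧ ∀ Q : ℝ, Q₀ ≤ Q →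
      ShrinkingDiskRealZeros (growth ν) (Q ^ 2) → AtMostOneRealZeroNear Q (Real.log Q ^ (-ε))

/-- Unfolding lemma: under the named fact, an admissible `ν`, `ε > 0` and `H_f` on `𝒮(Q²)` for
`Q ≥ Q₀(ν, ε)` give the two-clause «at most one» conclusion at scale `Q`.
[cite: BasakPratt2026, Theorem 1.2] -/
theorem basakPratt2026_theorem12.apply (h : basakPratt2026_theorem12) {ν : ℝ → ℝ}
    (hpos : ∀ x, 0 < ν x) (hν : Tendsto ν atTop (nhds 0)) (hmono : MonotoneOn (growth ν) (Set.Ioi 1))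
    (hinf : Tendsto (growth ν) atTop atTop) {ε : ℝ} (hε : 0 < ε) :
    ∃ Q₀ : ℝ, 1 ≤ Q₀ ∧ ∀ Q : ℝ, Q₀ ≤ Q →
      ShrinkingDiskRealZeros (growth ν) (Q ^ 2) → AtMostOneRealZeroNear Q (Real.log Q ^ (-ε)) :=
  h ν hpos hν hmono hinf ε hε

end Literature.NumberTheory.LFunctions

end
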